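import Mathlib
import HarnessLib
import Literature.NumberTheory.Rogawski1990.Ch13Sec6

/-!
# R90-TF S10 support — the five `UnrHatPins` of FILE D from RESTRICTED pure tensors and BOUNDED, STAR-FIXED e.v.p.'s

Pure book-keeping for §13.7's separation step («the homomorphisms `f ↦ f^∧(t)` … separate the e.v.p.'s», Rogawski 1990 §13.7 p. 211, after
Langlands): in the carpet currency ★ `Literature.NumberTheory.Rogawski1990.Ch13Sec6.EigenvaluePackage S 𝓗` (`t = (t_v)_{v ∉ S}`, `t_v : 𝓗_v →ₐ[ℂ] ℂ`) with
★ `EigenvaluePackage.hat t f = ∏ᶠ_{v ∉ S} t_v(f_v)`, take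

* `Unr` := the RESTRICTED pure tensors `f = (f_v)_{v ∉ S}`, `f_v = 1` for almost all `v` (`(mulSupport f).Finite`) — closed under componentwise product, under any
  componentwise self-map `σ_v` with `σ_v 1 = 1` (the `*` of `𝓗_v`), and containing the unit;
* `Germ` := the e.v.p.'s `t` with `‖t_v(x)‖ ≤ bd_v(x)` for a fixed bound function (for unitary spherical `π_v`: `|t_v(f)| ≤ ‖f‖_{L¹}`) and `t_v(σ_v x) = conj (t_v x)`
  (unitarity: the spherical function is positive definite).

THEN the five pins of FILE D's `UnrHatPinsHyp` (★ `Literature.Topology.separation_of_injective_bounded_starClosed`'s hypotheses) hold for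
`hat t f := t.hat f`: injective (test against `Pi.mulSingle v x`), bounded per `f` (a finite product of bounds), multiplicative (`finprod_mul_distrib`), star-closed,
unital.  The two analytic inputs (the bound and the `*`-law for eigencharacters of unitary spherical classes) are thereby ISOLATED as the membership conditions of
`Germ`; this file proves only the finite-product algebra. [cite: Rogawski1990, §13.6 p. 209, §13.7 p. 211]
-/

set_option linter.dupNamespace false

noncomputable section

namespace Summit.HodgeConjecture.HodgeConjecture.R90.S10

open Literature.NumberTheory.Rogawski1990.Ch13Sec6

/-- **The five `hat`-pins from restricted tensors and bounded star-fixed e.v.p.'s.**  With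
`Germ := {t : EigenvaluePackage S 𝓗 // (∀ v x, ‖t v x‖ ≤ bd v x) ∧ ∀ v x, t v (σ v x) = conj (t v x)}` and `Unr := {f : Π_{v ∉ S} 𝓗_v // (mulSupport f).Finite}`,
the map `hat t f := t.1.hat f.1` is injective, bounded in `t` for each `f`, and `Unr` carries products, `σ`-images and a unit on which `hat t` is multiplicative,
conjugate, and `1`. [cite: Rogawski1990, §13.6 p. 209 («f^∧(t) = Π t_v(f_v)»), §13.7 p. 211] -/
theorem unrHatPins_of_restricted {ι : Type*} (S : Set ι) (𝓗 : ι → Type*) [∀ i, Semiring (𝓗 i)] [∀ i, Algebra ℂ (𝓗 i)]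
    (bd : ∀ i : {i : ι // i ∉ S}, 𝓗 i.1 → ℝ) (σ : ∀ i : {i : ι // i ∉ S}, 𝓗 i.1 → 𝓗 i.1) (hσ : ∀ i, σ i 1 = 1) :
    (Function.Injective fun (t : {t : EigenvaluePackage S 𝓗 // (∀ i x, ‖t i x‖ ≤ bd i x) ∧ ∀ i x, t i (σ i x) = (starRingEnd ℂ) (t i x)})
        (f : {f : ∀ i : {i : ι // i ∉ S}, 𝓗 i.1 // {i | f i ≠ 1}.Finite}) => t.1.hat f.1) ∧
    (∀ f : {f : ∀ i : {i : ι // i ∉ S}, 𝓗 i.1 // {i | f i ≠ 1}.Finite}, ∃ C : ℝ,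
        ∀ t : {t : EigenvaluePackage S 𝓗 // (∀ i x, ‖t i x‖ ≤ bd i x) ∧ ∀ i x, t i (σ i x) = (starRingEnd ℂ) (t i x)}, ‖t.1.hat f.1‖ ≤ C) ∧
    (∀ f g : {f : ∀ i : {i : ι // i ∉ S}, 𝓗 i.1 // {i | f i ≠ 1}.Finite}, ∃ h : {f : ∀ i : {i : ι // i ∉ S}, 𝓗 i.1 // {i | f i ≠ 1}.Finite},
        ∀ t : {t : EigenvaluePackage S 𝓗 // (∀ i x, ‖t i x‖ ≤ bd i x) ∧ ∀ i x, t i (σ i x) = (starRingEnd ℂ) (t i x)}, t.1.hat h.1 = t.1.hat f.1 * t.1.hat g.1) ∧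
    (∀ f : {f : ∀ i : {i : ι // i ∉ S}, 𝓗 i.1 // {i | f i ≠ 1}.Finite}, ∃ g : {f : ∀ i : {i : ι // i ∉ S}, 𝓗 i.1 // {i | f i ≠ 1}.Finite},
        ∀ t : {t : EigenvaluePackage S 𝓗 // (∀ i x, ‖t i x‖ ≤ bd i x) ∧ ∀ i x, t i (σ i x) = (starRingEnd ℂ) (t i x)}, t.1.hat g.1 = (starRingEnd ℂ) (t.1.hat f.1)) ∧
    (∃ e : {f : ∀ i : {i : ι // i ∉ S}, 𝓗 i.1 // {i | f i ≠ 1}.Finite},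
        ∀ t : {t : EigenvaluePackage S 𝓗 // (∀ i x, ‖t i x‖ ≤ bd i x) ∧ ∀ i x, t i (σ i x) = (starRingEnd ℂ) (t i x)}, t.1.hat e.1 = 1) := by
  classical
  -- the support of `v ↦ t_v(f_v)` sits inside `{v | f_v ≠ 1}` (algebra maps send `1 ↦ 1`)
  have hsupp : ∀ (t : EigenvaluePackage S 𝓗) (f : ∀ i : {i : ι // i ∉ S}, 𝓗 i.1),
      (Function.mulSupport fun i => t i (f i)) ⊆ {i | f i ≠ 1} := by
    intro t f i hi
    simp only [Function.mem_mulSupport, ne_eq, Set.mem_setOf_eq] at hi ⊢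
    intro h1
    exact hi (by rw [h1, map_one])
  refine ⟨?_, ?_, ?_, ?_, ?_⟩
  · -- injective: test against the restricted tensor `mulSingle i x`
    intro t t' htt'
    apply Subtype.ext
    funext i
    apply AlgHom.ext
    intro x
    have hfin : {j : {j : ι // j ∉ S} | (Pi.mulSingle i x : ∀ j : {j : ι // j ∉ S}, 𝓗 j.1) j ≠ 1}.Finite := by
      refine (Set.finite_singleton i).subset fun j hj => ?_
      simp only [ne_eq, Set.mem_setOf_eq] at hj
      by_contra hji
      exact hj (Pi.mulSingle_eq_of_ne (M := fun j : {j : ι // j ∉ S} => 𝓗 j.1) hji x)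
    have key := congr_fun htt' ⟨Pi.mulSingle i x, hfin⟩
    have hev : ∀ s : EigenvaluePackage S 𝓗, s.hat (Pi.mulSingle i x) = s i x := by
      intro s
      unfold EigenvaluePackage.hat
      rw [finprod_eq_single _ i]
      · rw [Pi.mulSingle_eq_same]
      · intro j hj
        rw [Pi.mulSingle_eq_of_ne hj, map_one]
    simpa only [hev] using key
  · -- bounded per `f`: a finite product of the bounds
    intro f
    refine ⟨∏ i ∈ f.2.toFinset, max (bd i (f.1 i)) 1, fun t => ?_⟩
    show ‖EigenvaluePackage.hat t.1 f.1‖ ≤ _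
    unfold EigenvaluePackage.hat
    rw [finprod_eq_prod_of_mulSupport_subset _ (show (Function.mulSupport fun i => t.1 i (f.1 i)) ⊆ ↑f.2.toFinset by
      rw [Set.Finite.coe_toFinset]; exact hsupp t.1 f.1), norm_prod]
    refine Finset.prod_le_prod (fun i _ => norm_nonneg _) fun i _ => ?_
    exact (t.2.1 i (f.1 i)).trans (le_max_left _ _)
  · -- multiplicative: the componentwise product is again restricted
    intro f g
    have hfg : {i : {i : ι // i ∉ S} | (f.1 * g.1) i ≠ 1}.Finite := by
      refine (f.2.union g.2).subset fun i hi => ?_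
      simp only [ne_eq, Set.mem_setOf_eq, Pi.mul_apply, Set.mem_union] at hi ⊢
      by_contra h
      simp only [not_or, not_not] at h
      exact hi (by rw [h.1, h.2, one_mul])
    refine ⟨⟨f.1 * g.1, hfg⟩, fun t => ?_⟩
    show EigenvaluePackage.hat t.1 (f.1 * g.1) = EigenvaluePackage.hat t.1 f.1 * EigenvaluePackage.hat t.1 g.1
    unfold EigenvaluePackage.hat
    simp only [Pi.mul_apply, map_mul]
    exact finprod_mul_distrib (f.2.subset (hsupp t.1 f.1)) (g.2.subset (hsupp t.1 g.1))
  · -- star-closed: the componentwise `σ`-image is again restricted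
    intro f
    have hσf : {i : {i : ι // i ∉ S} | σ i (f.1 i) ≠ 1}.Finite := by
      refine f.2.subset fun i hi => ?_
      simp only [ne_eq, Set.mem_setOf_eq] at hi ⊢
      intro h1
      exact hi (by rw [h1, hσ])
    refine ⟨⟨fun i => σ i (f.1 i), hσf⟩, fun t => ?_⟩
    show EigenvaluePackage.hat t.1 (fun i => σ i (f.1 i)) = (starRingEnd ℂ) (EigenvaluePackage.hat t.1 f.1)
    unfold EigenvaluePackage.hat
    simp only [t.2.2]
    exact (map_finprod (starRingEnd ℂ) (f.2.subset (hsupp t.1 f.1))).symm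
  · -- unital
    refine ⟨⟨1, by simp⟩, fun t => ?_⟩
    show EigenvaluePackage.hat t.1 1 = 1
    unfold EigenvaluePackage.hat
    simp
end Summit.HodgeConjecture.HodgeConjecture.R90.S10

end
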